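import Literature.NumberTheory.GaloisRepresentations.LubinTateColemanRelativeGaloisTwo
import HarnessLib

/-!
# The action of `Gal(F̄/E)` on the norm-coherent units along `E·K_π^{m+1}` and de Shalit's Cor. I.2.3 (iv):
# `g_{σβ} = g_β ∘ [χ_π(σ)]_f` (unramified base, `q = 2`)

De Shalit, *Iwasawa theory of elliptic curves with complex multiplication* (1987), Ch. I §2.3 (iv), §3.4 Lemma (ii): the group
`G = Gal(k_ξ/k')` acts on `𝒰` termwise and `g_{σ(β)} = g_β ∘ [κ(σ)]_f`.  Over the unramified base `E ⊆ F^{nr}` (finite Galois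
over `F`): for `σ̃ ∈ Γ_F` fixing `E` pointwise the restrictions `σ̃|_{E·K_π^{m+1}}` (`relRestrict`) are compatible with the tower
and commute with the relative norms, so `β ↦ σ̃·β` (`RelNormCoherentUnits.galAct`) is an action on norm-coherent units; combined
with `LubinTateColemanRelativeGaloisTwo` this gives ★★ `relColemanSeries_galAct` — **`g_{σ̃·β} = g_β ∘ [χ_π(σ̃)]_f`**.  0 sorry.

## References

* E. de Shalit, *Iwasawa theory of elliptic curves with complex multiplication* (1987), Ch. I §2.3 (iv), §3.4 Lemma (ii). [deShalit1987]
-/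

noncomputable section

open Filter Topology
open scoped PowerSeries.WithPiTopology

namespace Literature.NumberTheory.GaloisRepresentations

section RelativeGaloisActionTwo

open GaloisRepresentations.IsNonarchimedeanLocalField LubinTate ValuativeRel Field

variable {F : Type} [Field F] [ValuativeRel F] [TopologicalSpace F] [IsNonarchimedeanLocalField F]

attribute [local instance] ltNormUniformSpace ltNormIsUniformAddGroup rk1 nF nE fintypeResidueField

variable {π : 𝒪[F]} (hπ : (valuation F).IsUniformizer (π : F))
variable (E : IntermediateField F (AlgebraicClosure F)) [FiniteDimensional F E] [Normal F E]

/-! ### Compatibility of the restrictions `σ̃|_{E·K_π^{m+1}}` with the tower and with the norms -/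

omit [FiniteDimensional F E] in
/-- The restrictions of `σ̃ ∈ Γ_F` to `E·K_π^{n+1} ≤ E·K_π^{m+1}` are compatible with the inclusion (both are `σ̃`).
[cite: deShalit1987, Ch. I §1.8] -/
theorem relRestrict_inclusion {n m : ℕ} (hnm : n ≤ m) (σ : absoluteGaloisGroup F)
    (y : (E ⊔ ltField π n : IntermediateField F (AlgebraicClosure F))) :
    relRestrict hπ E m σ (IntermediateField.inclusion (sup_le_sup_left (ltField_mono hπ hnm) E) y) =
      IntermediateField.inclusion (sup_le_sup_left (ltField_mono hπ hnm) E) (relRestrict hπ E n σ y) := by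
  apply Subtype.ext
  rw [coe_relRestrict_apply, IntermediateField.coe_inclusion, IntermediateField.coe_inclusion, coe_relRestrict_apply]

omit [FiniteDimensional F E] in
/-- **Automorphisms commute with the relative norm**: `N_{E_m/E_n}(σ_m x) = σ_n(N_{E_m/E_n} x)` for the restrictions `σ_m`,
`σ_n` of one `σ̃ ∈ Γ_F` (Mathlib `Algebra.norm_eq_of_equiv_equiv`). [cite: deShalit1987, Ch. I §2.3 (iv)] -/
theorem towerNorm_relRestrict {n m : ℕ} (hnm : n ≤ m) (σ : absoluteGaloisGroup F)
    (x : (E ⊔ ltField π m : IntermediateField F (AlgebraicClosure F))) :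
    @Algebra.norm (E ⊔ ltField π n : IntermediateField F (AlgebraicClosure F))
        (E ⊔ ltField π m : IntermediateField F (AlgebraicClosure F)) _ _
        (towerAlgebra (sup_le_sup_left (ltField_mono hπ hnm) E)) (relRestrict hπ E m σ x) =
      relRestrict hπ E n σ (@Algebra.norm (E ⊔ ltField π n : IntermediateField F (AlgebraicClosure F))
        (E ⊔ ltField π m : IntermediateField F (AlgebraicClosure F)) _ _
        (towerAlgebra (sup_le_sup_left (ltField_mono hπ hnm) E)) x) := by
  letI := towerAlgebra (sup_le_sup_left (ltField_mono hπ hnm) E)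
  have h := Algebra.norm_eq_of_equiv_equiv (relRestrict hπ E n σ).toRingEquiv (relRestrict hπ E m σ).toRingEquiv
    (RingHom.ext fun y => (relRestrict_inclusion hπ E hnm σ y).symm) x
  -- `h : N x = σ_n⁻¹ (N (σ_m x))`
  rw [h]
  change _ = relRestrict hπ E n σ ((relRestrict hπ E n σ).symm
    (@Algebra.norm (E ⊔ ltField π n : IntermediateField F (AlgebraicClosure F))
        (E ⊔ ltField π m : IntermediateField F (AlgebraicClosure F)) _ _
        (towerAlgebra (sup_le_sup_left (ltField_mono hπ hnm) E)) (relRestrict hπ E m σ x)))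
  rw [AlgEquiv.apply_symm_apply]

/-! ### The action on norm-coherent units and Cor. 2.3 (iv) -/

namespace RelNormCoherentUnits

variable {hπ E}

/-- **`σ̃ · β`**: the termwise action of `σ̃ ∈ Γ_F` on a norm-coherent sequence of units along `E·K_π^{m+1}` (through the
restrictions `σ̃|_{E·K_π^{m+1}}`; norms and absolute values are preserved). [cite: deShalit1987, Ch. I §2.3 (iv), §3.4 Lemma (ii)] -/
def galAct (σ : absoluteGaloisGroup F) (β : RelNormCoherentUnits hπ E) : RelNormCoherentUnits hπ E where
  val m := toUnitBallHom (relRestrict hπ E m σ) (β.val m)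
  norm_eq_one m := by rw [coe_toUnitBallHom, norm_algEquiv, β.norm_eq_one]
  coherent n m hnm := by rw [coe_toUnitBallHom, coe_toUnitBallHom, towerNorm_relRestrict hπ E hnm, β.coherent n m hnm]

/-- Components of `σ̃ · β` (unfolding). [cite: deShalit1987, Ch. I §2.3 (iv)] -/
theorem coe_val_galAct (σ : absoluteGaloisGroup F) (β : RelNormCoherentUnits hπ E) (m : ℕ) :
    (((β.galAct σ).val m : unitBall (E ⊔ ltField π m : IntermediateField F (AlgebraicClosure F))) :
      (E ⊔ ltField π m : IntermediateField F (AlgebraicClosure F))) =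
      relRestrict hπ E m σ ((β.val m : unitBall (E ⊔ ltField π m : IntermediateField F (AlgebraicClosure F))) :
        (E ⊔ ltField π m : IntermediateField F (AlgebraicClosure F))) := rfl

/-- `σ̃ · (β β') = (σ̃ · β)(σ̃ · β')`. [cite: deShalit1987, Ch. I §3.4 Lemma (ii)] -/
theorem galAct_mul (σ : absoluteGaloisGroup F) (β β' : RelNormCoherentUnits hπ E) :
    (β.mul β').galAct σ = (β.galAct σ).mul (β'.galAct σ) := by
  refine RelNormCoherentUnits.ext fun m => ?_
  change toUnitBallHom (relRestrict hπ E m σ) (β.val m * β'.val m) = _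
  rw [map_mul]
  rfl

end RelNormCoherentUnits

variable [IsGalois F E] (hq : residueFieldCard F = 2) (hE : E ≤ maxUnramified F) {σ₀ : absoluteGaloisGroup F}
  (hσ₀ : IsAbsArithFrob σ₀)

/-- ★★ **De Shalit's Cor. I.2.3 (iv) over the unramified base: `g_{σ̃·β} = g_β ∘ [χ_π(σ̃)]_f`** for `σ̃ ∈ Γ_F` fixing `E`
pointwise (`χ_π = lubinTateChar`). [cite: deShalit1987, Ch. I §2.3 (iv)] -/
theorem relColemanSeries_galAct (β : RelNormCoherentUnits hπ E) {σ : absoluteGaloisGroup F}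
    (hσE : ∀ x : E, σ • (x : AlgebraicClosure F) = x) :
    relColemanSeries hπ E hq hE hσ₀ (β.galAct σ) =
      (relColemanSeries hπ E hq hE hσ₀ β).subst (homE hπ E (lubinTateChar hπ σ : 𝒪[F])) :=
  relColemanSeries_eq_subst_homE hπ E hq hE hσ₀ β (β.galAct σ) hσE fun _ => rfl

end RelativeGaloisActionTwo

end Literature.NumberTheory.GaloisRepresentations
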